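import Summits.BirchSwinnertonDyer.BirchSwinnertonDyer.Theorems.KolyvaginDepthDoorKolyvaginDepthSupplyDatumDoor
import Summits.BirchSwinnertonDyer.BirchSwinnertonDyer.Theorems.KolyvaginDepthDoorDepthTableGlobalMinimal
import Literature.Barriers.BirchSwinnertonDyer.RankNotSumOfLocalInvariantsDescentNeg1
import Literature.NumberTheory.EllipticCurves.ComplexMultiplicationRationalJIntegralProofs
import HarnessLib

/-!
# Route `KolyvaginDepthDoor`, crux `KolyvaginDepthSupply` (stmt-BirchSwinnertonDyer-21765) —
# the DATUM and SYSTEM forms `KolyvaginDepthSupplyDatum` / `KolyvaginDepthSupplySystem` are FALSE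
# AS STATED (rank-`0` non-CM curves exist): an audit of the planner-facing re-typing, with witness

Helper file (`--supports stmt-BirchSwinnertonDyer-21765 --as helper`); it closes nothing, refutes NO
ledger item (the two `Prop`s are route-posited `@[conjecture]` definitions of
`Theorems/KolyvaginDepthDoorDefs.lean`, not `Theses` declarations), and BSD is not proved by it.

WHAT IS REFUTED. Both definitions quantify over EVERY non-CM globally minimal elliptic `E/ℚ` and
demand a square-free `n₁` with `#{q ∣ n₁} + 1 ≤ rank_ℤ E(ℚ)` — so they assert in particular that
every non-CM elliptic curve over `ℚ` has POSITIVE Mordell–Weil rank. The tree holds an unconditional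
complete `2`-descent (`Literature.Barriers.…DokchitserDokchitser2011.mordellWeilRank_twist_neg1_eq_zero`,
Silverman AEC X.1.4): the curve `E₀ : y² = x³ + x² − 6x = x(x − 2)(x + 3)` (the `(−1)`-twist of
Cremona's `480a1`; `Δ = 14400 = 2⁶·3²·5²`, `c₄ = 304`, `j = 2¹²·19³ / (2⁶·3²·5²) ∉ ℤ`) has
`rank_ℤ E₀(ℚ) = 0`. Its integral equation `[0, 1, 0, −6, 0]` is a global minimal model
(`|Δ| < 3¹²`, `2¹² ∤ Δ`; `isGloballyMinimal_map_int_of_natAbs_Δ_lt`) and it has no CM (`j ∉ ℤ`,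
whereas CM curves over `ℚ` have integral `j`: `exists_intCast_eq_j_of_hasCM`, Silverman ATAEC
II.6.1). Hence:

* `not_kolyvaginDepthSupplyDatum : ¬ KolyvaginDepthSupplyDatum`;
* `not_kolyvaginDepthSupplySystem : ¬ KolyvaginDepthSupplySystem`
  (through g7's `kolyvaginDepthSupplyDatum_of_kolyvaginDepthSupplySystem`).

WHAT IS NOT REFUTED. The route's crux `KolyvaginDepthSupply` itself (stmt-21765) is untouched: its
rank clause is the DISJUNCTION `(ν(n)+1 = rank E(ℚ) > rank E^{(d_K)}(ℚ)) ∨ (ν(n) = rank E(ℚ) =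
rank E^{(d_K)}(ℚ) − 1)`, whose second member is the habitat of rank-`0` curves (`ν = 0`, a
non-zero class of the Heegner point `y_K`, twist of rank `1`). The datum/system forms dropped that
second member (g6/g7 wrote them for the rank-`≥ 2` door, where only the first member is exercised)
but kept the universal quantifier over all non-CM curves. CONSEQUENCE FOR THE PLANNER (g8's hand-back
recommended "re-type the crux as `KolyvaginDepthSupplyDatum`"): re-typing the crux by either
definition AS IT STANDS files a refutable crux; every `…_of_kolyvaginDepthSupplyDatum[_print]`
theorem of g7/g8 (`bsd_of_kolyvaginDepthSupplyDatum`, `bsd_of_kolyvaginDepthSupplyDatum_print`,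
`shaCorankZeroAtOnePrime_of_kolyvaginDepthSupplyDatum[_print]`) has a FALSE antecedent. The doors OF A
DATUM (`shaCorank_eq_zero_of_kolyvaginClass_ne_zero_of_rank_le_of_datum…`, the rows, the kits) are
per-curve statements with the rank hypothesis displayed and are NOT affected. The repaired datum form
(second disjunct restored: `ν ≤ rank E(ℚ) ∧ ν + 1 ≤ rank E^{(d_K)}(ℚ)`, read through the TOTAL bound
`#Sel_p(E/K) ≤ p^{2ν+1}`) is the business of a sibling file (signed datum form), not of this one.

References: [SilvermanAEC2009] Prop. X.1.4 (complete 2-descent), VII.1 Rem. 1.1, VIII.8;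
[SilvermanATAEC1994] Thm. II.6.1; [DokchitserDokchitser2011RankModN] proof of Thm. 2 (the curve
480a1); [Kolyvagin1991MathAnn] Thm. 2.3 (the two eigenspaces).
-/

set_option linter.dupNamespace false

noncomputable section

open scoped Classical

namespace Summit.BirchSwinnertonDyer.BirchSwinnertonDyer.Theorems.KolyvaginDepthDoor

open Literature.NumberTheory.EllipticCurves WeierstrassCurve
open Literature.Barriers.BirchSwinnertonDyer Literature.Barriers.BirchSwinnertonDyer.DokchitserDokchitser2011

/-! ## §1 The witness `E₀ : y² = x³ + x² − 6x` (the `(−1)`-twist of `480a1`), rank `0`, non-CM, minimal -/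

/-- The tree's `curve480a1.quadraticTwist (-1)` IS the rational equation `[0, 1, 0, −6, 0]`
(`b₂(480a1) = −4`, `b₄ = −12`, `b₆ = 0`; the twist by `d = −1` is `[0, d b₂/4, 0, d² b₄/2, d³ b₆/4] =
[0, 1, 0, −6, 0]`). [cite: SilvermanAEC2009, X.2 (quadratic twists)] -/
theorem quadraticTwist_curve480a1_neg_one_eq :
    curve480a1.quadraticTwist (-1) = (⟨0, 1, 0, -6, 0⟩ : WeierstrassCurve ℤ).map (Int.castRingHom ℚ) := by
  ext <;> norm_num [WeierstrassCurve.quadraticTwist, curve480a1, WeierstrassCurve.b₂,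
    WeierstrassCurve.b₄, WeierstrassCurve.b₆, WeierstrassCurve.map]

/-- `E₀` is an elliptic curve: `Δ = 14400 ≠ 0` (kernel-checked). [cite: SilvermanAEC2009, III.1] -/
theorem isElliptic_twist480a1 : ((⟨0, 1, 0, -6, 0⟩ : WeierstrassCurve ℤ).map (Int.castRingHom ℚ)).IsElliptic := by
  rw [WeierstrassCurve.isElliptic_iff, WeierstrassCurve.map_Δ, isUnit_iff_ne_zero, eq_intCast,
    Int.cast_ne_zero]
  decide +kernel

/-- `[0, 1, 0, −6, 0]` is a GLOBAL MINIMAL equation over `ℚ`: `|Δ| = 14400 < 3¹²` and `2¹² ∤ Δ`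
(`isGloballyMinimal_map_int_of_natAbs_Δ_lt`, kernel-checked). [cite: SilvermanAEC2009, VII.1 Remark 1.1 and VIII.8] -/
theorem isGloballyMinimal_twist480a1 : ((⟨0, 1, 0, -6, 0⟩ : WeierstrassCurve ℤ).map (Int.castRingHom ℚ)).IsGloballyMinimal :=
  isGloballyMinimal_map_int_of_natAbs_Δ_lt _ (by decide +kernel) (by decide +kernel) (by decide +kernel)

/-- `rank_ℤ E₀(ℚ) = 0` — the tree's unconditional complete `2`-descent for the `(−1)`-twist of `480a1`
(`mordellWeilRank_twist_neg1_eq_zero`), transported along `quadraticTwist_curve480a1_neg_one_eq`.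
[cite: SilvermanAEC2009, Prop. X.1.4] [cite: DokchitserDokchitser2011RankModN, proof of Thm. 2] -/
theorem mordellWeilRank_twist480a1 : ((⟨0, 1, 0, -6, 0⟩ : WeierstrassCurve ℤ).map (Int.castRingHom ℚ)).mordellWeilRank = 0 := by
  rw [← quadraticTwist_curve480a1_neg_one_eq]
  exact mordellWeilRank_twist_neg1_eq_zero

/-- `E₀` has no complex multiplication: `j(E₀) = c₄³/Δ = 304³/14400` is not an integer (`14400 ∤ 304³`,
kernel-checked), whereas a CM elliptic curve over `ℚ` has integral `j` (`exists_intCast_eq_j_of_hasCM`).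
[cite: SilvermanATAEC1994, Thm. II.6.1] [cite: SilvermanAEC2009, App. C §11] -/
theorem not_hasCM_twist480a1 : ¬ ((⟨0, 1, 0, -6, 0⟩ : WeierstrassCurve ℤ).map (Int.castRingHom ℚ)).HasCM := by
  haveI := isElliptic_twist480a1
  intro hCM
  obtain ⟨n, hn⟩ := ((⟨0, 1, 0, -6, 0⟩ : WeierstrassCurve ℤ).map (Int.castRingHom ℚ)).exists_intCast_eq_j_of_hasCM hCM
  have hc₄ : ((⟨0, 1, 0, -6, 0⟩ : WeierstrassCurve ℤ).map (Int.castRingHom ℚ)).c₄ = ((⟨0, 1, 0, -6, 0⟩ : WeierstrassCurve ℤ).c₄ : ℚ) := by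
    rw [WeierstrassCurve.map_c₄, eq_intCast]
  have hΔ : ((⟨0, 1, 0, -6, 0⟩ : WeierstrassCurve ℤ).map (Int.castRingHom ℚ)).Δ = ((⟨0, 1, 0, -6, 0⟩ : WeierstrassCurve ℤ).Δ : ℚ) := by
    rw [WeierstrassCurve.map_Δ, eq_intCast]
  have hj : (n : ℚ) * ((⟨0, 1, 0, -6, 0⟩ : WeierstrassCurve ℤ).Δ : ℚ) = ((⟨0, 1, 0, -6, 0⟩ : WeierstrassCurve ℤ).c₄ : ℚ) ^ 3 := by
    have hΔ0 : ((⟨0, 1, 0, -6, 0⟩ : WeierstrassCurve ℤ).map (Int.castRingHom ℚ)).Δ ≠ 0 :=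
      ((⟨0, 1, 0, -6, 0⟩ : WeierstrassCurve ℤ).map (Int.castRingHom ℚ)).isUnit_Δ.ne_zero
    rw [← hΔ, ← hc₄, hn, WeierstrassCurve.j, Units.val_inv_eq_inv_val, WeierstrassCurve.coe_Δ']
    field_simp
  have hj' : n * (⟨0, 1, 0, -6, 0⟩ : WeierstrassCurve ℤ).Δ = (⟨0, 1, 0, -6, 0⟩ : WeierstrassCurve ℤ).c₄ ^ 3 := by exact_mod_cast hj
  have hdvd : (⟨0, 1, 0, -6, 0⟩ : WeierstrassCurve ℤ).Δ ∣ (⟨0, 1, 0, -6, 0⟩ : WeierstrassCurve ℤ).c₄ ^ 3 := ⟨n, by rw [← hj', mul_comm]⟩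
  exact absurd hdvd (by decide +kernel)

/-! ## §2 The two route-posited forms are false -/

/-- **`KolyvaginDepthSupplyDatum` is FALSE as stated.** The definition (file `…KolyvaginDepthDoorDefs`)
asks, for EVERY non-CM globally minimal elliptic `E/ℚ`, for a datum with `#{q ∣ n₁} + 1 ≤ rank_ℤ E(ℚ)`,
hence for `rank_ℤ E(ℚ) ≥ 1`; the non-CM global minimal equation `E₀ : y² = x³ + x² − 6x` (the
`(−1)`-twist of `480a1`) has `rank_ℤ E₀(ℚ) = 0` by the tree's complete `2`-descent. The crux
`KolyvaginDepthSupply` (stmt-BirchSwinnertonDyer-21765) is NOT refuted by this: its rank clause has the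
second member `ν(n) = rank E(ℚ) = rank E^{(d_K)}(ℚ) − 1`, the habitat of rank-`0` curves, which the
datum form dropped. Repair: restore that member (signed datum form, sibling file).
[cite: SilvermanAEC2009, Prop. X.1.4] [cite: Kolyvagin1991MathAnn, Thm. 2.3] -/
theorem not_kolyvaginDepthSupplyDatum : ¬ KolyvaginDepthSupplyDatum := by
  intro h
  haveI := isElliptic_twist480a1
  haveI := isGloballyMinimal_twist480a1
  obtain ⟨p, hp, -, -, -, -, K, _, _, -, -, -, _, -, Dt, β, ι, n₁, d, -, -, -, hrank⟩ :=
    h ((⟨0, 1, 0, -6, 0⟩ : WeierstrassCurve ℤ).map (Int.castRingHom ℚ)) not_hasCM_twist480a1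
  rw [mordellWeilRank_twist480a1] at hrank
  omega

/-- **`KolyvaginDepthSupplySystem` is FALSE as stated** — it implies the datum form
(`kolyvaginDepthSupplyDatum_of_kolyvaginDepthSupplySystem`, g7), refuted above by the rank-`0` non-CM
curve `y² = x³ + x² − 6x`. The crux `KolyvaginDepthSupply` is not refuted by this.
[cite: SilvermanAEC2009, Prop. X.1.4] [cite: Kolyvagin1991MathAnn, Thm. 2.3] -/
theorem not_kolyvaginDepthSupplySystem : ¬ KolyvaginDepthSupplySystem := fun h ↦
  not_kolyvaginDepthSupplyDatum (kolyvaginDepthSupplyDatum_of_kolyvaginDepthSupplySystem h)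

end Summit.BirchSwinnertonDyer.BirchSwinnertonDyer.Theorems.KolyvaginDepthDoor

end
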